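/-
COR-CM (cell pub-hodgecm2, stage 2 of the Hodge ladder) — count-neutral KERNEL COMBINATORICS «spectator doubling G = H × ⟨x⟩ (x a CENTRAL involution
outside the index-two subgroup H ∋ c), part I: the square obligations of the split index-two checklist follow from the PARALLEL faces at neighbour
types» (seat prover-pub-hodgecm2-b23-g47-0, binder prover b23, gen 47; claim «SPECTATOR DOUBLING», HOME/INBOX.md l.21993).  Theorems only, on top of
gen 46ʼs `Census/IndexTwoSplitOrbits` and `Census/IndexTwoSplitPrism` (prism identity) BY NAME; no `decide`, no certificate, no named fact, no
`sorry`; `Interfaces.lean` (C1), every E term, B01, `Transposition/*`, `PortJoin/*`, `D2Bridge/*` untouched.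
HONEST FRAMING: `HC_CM` is NOT proved, here or anywhere in the tree; nothing here is a period, a count of record or a headline.
T5: n/a-class (hypothesis binders: `c * c = 1`, `c ≠ 1`, `c` central, `c ∈ H`, `H.index = 2`, `x ∉ H`, `x * x = 1`, `x` central); checker: self.
-/
import Summits.HodgeConjecture.CorCM.Census.IndexTwoSplitOrbits
import Summits.HodgeConjecture.CorCM.Census.IndexTwoSplitPrism

/-!
# Spectator doubling `G = H × ⟨x⟩`, I: the square obligations from parallel faces

THE SETTING of gen 41/46ʼs `Census/IndexTwoDescent*` / `Census/IndexTwoSplit*`: `G` finite, `c ≠ 1` a central involution, `H ∋ c` a subgroup of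
index two, `x ∉ H` with `x · x = 1` — and here moreover `x` CENTRAL.  Then `G = H × ⟨x⟩`; in field terms the Galois CM field `F` is the compositum
`F₀ · k` of a Galois CM field `F₀` (group `H`, complex conjugation `c`) with a real quadratic field `k` disjoint from it, and `x` generates
`Gal(F/F₀)`: the «spectator» involution.  Types of `(G, c)` are pairs `(res₀ Ψ, res₁ Ψ)` of types of `(H, c)`, base change along `H` is diagonal
and base change along `x` SWAPS the two coordinates (`res₀_rt_x`, `res₁_rt_x`); the distance `D(Ψ) = #{places where res₀ Ψ, res₁ Ψ differ}` sorts
the blocks into DIAGONAL (`D = 0`), NEIGHBOUR (`D = 1`) and FAR (`D ≥ 2`) blocks.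

* §1 Spectator base change: `res₀ (Ψ·x) = res₁ Ψ`, `res₁ (Ψ·x) = res₀ Ψ`, and the base change of a mixed face along `x` is the mixed face with the
  two coordinates exchanged (`mapDomain_rt_x_mixed`).
* §2 PARALLEL FACES `gface Θ m (x·m)` (flip one place of `H` in both coordinates) at NEIGHBOUR types give all TWO-CYCLE faces at diagonal types
  (`twoCycle_mem_of_parallel`: a two-cycle face is minus a parallel face at the adjacent neighbour type).
* §3 **THE SQUARE OBLIGATION FROM PARALLEL FACES** (`mixed_mem_of_parallel`): let `Ψ = (a, a^{(k)(l)})` be a type of distance `2` and suppose a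
  base-change-stable `N` contains every parallel face at every neighbour type and ONE of the two distance-lowering mixed faces at the partner type
  `(a^{(l)}, a^{(k)})`.  Then `N` contains the distance-lowering face `gface Ψ l (x·k)` — by the prism identity at the neighbour type `(a, a^{(k)})`
  (if the partner carries its `l`-first face) or at `(a^{(l)}, a)` followed by the swap `·x` (if it carries its `k`-first face).  Hence BOTH
  distance-lowering faces at every distance-`2` type, and the square elements of gen 46ʼs checklist, come for free (`square_mem_of_parallel`).
Part II (`Census/SpectatorClosing.lean`) turns this into the spectator checklist on block representatives and the count
`μ(G, c) ≤ |S| + #{far blocks} + (|H|/2) · #{neighbour blocks}`.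

## References
* [Pohlmann1968] H. Pohlmann, Algebraic cycles on abelian varieties of complex multiplication type, Ann. of Math. 88 (1968), Thm 1.
-/

namespace Summit.HodgeConjecture.CorCM.Census.Spectator

open Finset
open Summit.HodgeConjecture.CorCM.Prior.AllgGroup.RfwfAllgGroup
open Summit.HodgeConjecture.CorCM.Census.BlockParity
open Summit.HodgeConjecture.CorCM.Census.Coinvariant
open Summit.HodgeConjecture.CorCM.Census.ComplementFaces
open Summit.HodgeConjecture.CorCM.Census.IndexTwoDescent

noncomputable section

variable {G : Type*} [Group G] [Fintype G] [DecidableEq G] {c : G}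
variable {H : Subgroup G} [DecidablePred (· ∈ H)]

/-! ## §1 Spectator base change along `x` -/

/-- **Base change along the central involution `x` swaps the coordinates, `0`-side**: `res₀ (Ψ·x) = res₁ Ψ`. [folklore] -/
theorem res₀_rt_x (hcH : c ∈ H) (hcen : ∀ g : G, g * c = c * g) {x : G} (hxc : ∀ g : G, g * x = x * g) (Ψ : CMF G c) :
    res₀ hcH (rt c x Ψ) = res₁ hcH hcen x Ψ := by
  apply Subtype.ext; ext h
  rw [mem_res₀, mem_rt, mem_res₁, hxc]

/-- **Base change along the central involution `x` swaps the coordinates, `1`-side**: `res₁ (Ψ·x) = res₀ Ψ`. [folklore] -/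
theorem res₁_rt_x (hcH : c ∈ H) (hcen : ∀ g : G, g * c = c * g) {x : G} (hxx : x * x = 1) (hxc : ∀ g : G, g * x = x * g) (Ψ : CMF G c) :
    res₁ hcH hcen x (rt c x Ψ) = res₀ hcH Ψ := by
  apply Subtype.ext; ext h
  rw [mem_res₁, mem_rt, mem_res₀, ← hxc, mul_assoc, hxx, mul_one]

omit [DecidablePred (· ∈ H)] in
/-- **Base change along `x` of a mixed face exchanges the coordinates of its two places**:
`(gface Ψ k (x·l))·x = gface (Ψ·x) l (x·k)`. [folklore] -/
theorem mapDomain_rt_x_mixed (hc2 : c * c = 1) {x : G} (hxx : x * x = 1) (hxc : ∀ g : G, g * x = x * g) (Ψ : CMF G c) (k l : G) :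
    Finsupp.mapDomain (rt c x) (gface c hc2 Ψ k (x * l)) = gface c hc2 (rt c x Ψ) l (x * k) := by
  rw [mapDomain_rt_gface, gface_comm]
  have hxinv : x⁻¹ = x := inv_eq_of_mul_eq_one_right hxx
  rw [hxinv, mul_assoc, hxc l, ← mul_assoc, hxx, one_mul, hxc k]

/-! ## §2 Parallel faces at neighbour types give the two-cycle faces -/

/-- **Two-cycle faces from parallel faces**: if `N` contains every parallel face `gface Θ m (x·m)` at every NEIGHBOUR type `Θ`
(`res₁ Θ = (res₀ Θ)^{(t)}` for some `t`), it contains every two-cycle face `gface Θ m (x·m)` at every DIAGONAL type (`res₁ Θ = res₀ Θ`):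
the two-cycle face is minus the parallel face at the neighbour `Θ^{(x m)}`. [folklore] -/
theorem twoCycle_mem_of_parallel (hcH : c ∈ H) (hcen : ∀ g : G, g * c = c * g) (hc2 : c * c = 1) {x : G} (hx : x ∉ H)
    (N : Submodule ℤ (CMF G c →₀ ℤ))
    (hpar : ∀ (Θ : CMF G c) (t : H), res₁ hcH hcen x Θ = oflipCM (⟨c, hcH⟩ : H) (csub_mul_csub hcH hc2) t (res₀ hcH Θ) →
      ∀ m : H, gface c hc2 Θ (m : G) (x * (m : G)) ∈ N)
    (Θ : CMF G c) (hΘ : res₁ hcH hcen x Θ = res₀ hcH Θ) (m : H) : gface c hc2 Θ (m : G) (x * (m : G)) ∈ N := by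
  have e : gface c hc2 Θ (m : G) (x * (m : G)) = - gface c hc2 (oflipCM c hc2 (x * (m : G)) Θ) (m : G) (x * (m : G)) := by
    rw [gface_oflipCM_right, neg_neg]
  rw [e]
  refine Submodule.neg_mem _ (hpar _ m ?_ m)
  rw [res₁_oflipCM_mul, res₀_oflipCM_mul hcH hcen hc2 hx, hΘ]

/-! ## §3 The square obligation from parallel faces -/

section Square

variable {K : Type*} [Group K] [Fintype K] [DecidableEq K] (c' : K)

/-- **Weight `2` with two named deviations is a double flip**: if `wt T S = 2` and `k ≠ l` are deviations (`k, l ∈ T ∖ S`) then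
`T = S^{(l)(k)}`. [folklore] -/
theorem eq_oflipCM_oflipCM_of_wt_two (hc2' : c' * c' = 1) {T S : CMF K c'} (h2 : wt c' T S = 2) {k l : K}
    (hkT : k ∈ T.1) (hkS : k ∉ S.1) (hlT : l ∈ T.1) (hlS : l ∉ S.1) (hkl : k ≠ l) :
    T = oflipCM c' hc2' k (oflipCM c' hc2' l S) := by
  have h1 : wt c' T (oflipCM c' hc2' l S) = 1 := by
    have := wt_oflipCM_of_notMem c' hc2' hlT hlS; omega
  have hkS' : k ∉ (oflipCM c' hc2' l S).1 := by
    change k ∉ oflip c' l S.1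
    rw [oflip, mem_symmDiff, mem_orb]
    rintro (⟨hk, -⟩ | ⟨hk, -⟩)
    · exact hkS hk
    · rcases hk with rfl | rfl
      · exact hkl rfl
      · exact (T.2 l).mp hlT hkT
  have h0 : wt c' T (oflipCM c' hc2' k (oflipCM c' hc2' l S)) = 0 := by
    have := wt_oflipCM_of_notMem c' hc2' hkT hkS'; omega
  exact (eq_of_wt_eq_zero c' h0).symm

end Square

/-- The descent data of a mixed face at two named deviations `d ≠ d'` of a type of distance `≥ 2`: the three other corners have distance
`D − 1`, `D − 1`, `D − 2` (the computation of gen 46ʼs `exists_descending_mixed`, for GIVEN deviations). [folklore] -/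
theorem descends_of_devs (hcH : c ∈ H) (hcen : ∀ g : G, g * c = c * g) (hc2 : c * c = 1) {x : G} (hx : x ∉ H)
    (Ψ : CMF G c) {d d' : H} (hd1 : d ∈ (res₁ hcH hcen x Ψ).1) (hd0 : d ∉ (res₀ hcH Ψ).1)
    (hd'1 : d' ∈ (res₁ hcH hcen x Ψ).1) (hd'0 : d' ∉ (res₀ hcH Ψ).1) (hne : d ≠ d') :
    wt (⟨c, hcH⟩ : H) (res₁ hcH hcen x (oflipCM c hc2 (d : G) Ψ)) (res₀ hcH (oflipCM c hc2 (d : G) Ψ)) + 1 =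
        wt (⟨c, hcH⟩ : H) (res₁ hcH hcen x Ψ) (res₀ hcH Ψ) ∧
      wt (⟨c, hcH⟩ : H) (res₁ hcH hcen x (oflipCM c hc2 (x * (d' : G)) Ψ)) (res₀ hcH (oflipCM c hc2 (x * (d' : G)) Ψ)) + 1 =
        wt (⟨c, hcH⟩ : H) (res₁ hcH hcen x Ψ) (res₀ hcH Ψ) ∧
      wt (⟨c, hcH⟩ : H) (res₁ hcH hcen x (oflipCM c hc2 (d : G) (oflipCM c hc2 (x * (d' : G)) Ψ)))
          (res₀ hcH (oflipCM c hc2 (d : G) (oflipCM c hc2 (x * (d' : G)) Ψ))) + 2 =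
        wt (⟨c, hcH⟩ : H) (res₁ hcH hcen x Ψ) (res₀ hcH Ψ) := by
  have hc2' := csub_mul_csub hcH hc2
  refine ⟨?_, ?_, ?_⟩
  · rw [res₀_oflipCM_coe, res₁_oflipCM_coe hcH hcen hc2 hx]
    exact wt_oflipCM_of_notMem _ hc2' hd1 hd0
  · rw [res₀_oflipCM_mul hcH hcen hc2 hx, res₁_oflipCM_mul]
    exact wt_oflipCM_left_of_notMem _ hc2' hd'1 hd'0
  · rw [res₀_oflipCM_coe, res₁_oflipCM_coe hcH hcen hc2 hx, res₀_oflipCM_mul hcH hcen hc2 hx, res₁_oflipCM_mul]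
    have hd1' : d ∈ (oflipCM (⟨c, hcH⟩ : H) hc2' d' (res₁ hcH hcen x Ψ)).1 := by
      have hnot : d ∉ orb (⟨c, hcH⟩ : H) d' := by
        rw [mem_orb]
        rintro (rfl | rfl)
        · exact hne rfl
        · exact ((res₁ hcH hcen x Ψ).2 d').mp hd'1 hd1
      change d ∈ oflip (⟨c, hcH⟩ : H) d' (res₁ hcH hcen x Ψ).1
      rw [oflip, mem_symmDiff]
      exact Or.inl ⟨hd1, hnot⟩
    have h1 := wt_oflipCM_of_notMem _ hc2' (Ψ := res₀ hcH Ψ) hd1' hd0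
    have h2' := wt_oflipCM_left_of_notMem _ hc2' (Ψ := res₀ hcH Ψ) hd'1 hd'0
    omega

/-- **THE SQUARE OBLIGATION FROM PARALLEL FACES** (spectator case `x` central, `x·x = 1`).  Let `res₁ Ψ = (res₀ Ψ)^{(l)(k)}` with `k, l` at
distinct places (a type of distance `2`), let `N` be base-change stable, contain every parallel face at every neighbour type, and contain at the
PARTNER type `Ψ' = Ψ^{(l)(x l)}` (`res₀ Ψ' = (res₀ Ψ)^{(l)}`, `res₁ Ψ' = (res₀ Ψ)^{(k)}`) one of its two distance-lowering mixed faces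
`gface Ψ' l (x·k)`, `gface Ψ' k (x·l)`.  Then `gface Ψ l (x·k) ∈ N`. [folklore] -/
theorem mixed_mem_of_parallel (hcH : c ∈ H) (hcen : ∀ g : G, g * c = c * g) (hc2 : c * c = 1) (hH : H.index = 2) {x : G} (hx : x ∉ H)
    (hxx : x * x = 1) (hxc : ∀ g : G, g * x = x * g)
    (N : Submodule ℤ (CMF G c →₀ ℤ)) (hN : ∀ Q : G, ∀ y ∈ N, Finsupp.mapDomain (rt c Q) y ∈ N)
    (hpar : ∀ (Θ : CMF G c) (t : H), res₁ hcH hcen x Θ = oflipCM (⟨c, hcH⟩ : H) (csub_mul_csub hcH hc2) t (res₀ hcH Θ) →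
      ∀ m : H, gface c hc2 Θ (m : G) (x * (m : G)) ∈ N)
    (Ψ : CMF G c) (k l : H)
    (hΨ : res₁ hcH hcen x Ψ = oflipCM (⟨c, hcH⟩ : H) (csub_mul_csub hcH hc2) k
      (oflipCM (⟨c, hcH⟩ : H) (csub_mul_csub hcH hc2) l (res₀ hcH Ψ)))
    (hpartner : gface c hc2 (oflipCM c hc2 (l : G) (oflipCM c hc2 (x * (l : G)) Ψ)) (l : G) (x * (k : G)) ∈ N ∨
      gface c hc2 (oflipCM c hc2 (l : G) (oflipCM c hc2 (x * (l : G)) Ψ)) (k : G) (x * (l : G)) ∈ N) :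
    gface c hc2 Ψ (l : G) (x * (k : G)) ∈ N := by
  have hc2' := csub_mul_csub hcH hc2
  set c₁ : H := ⟨c, hcH⟩ with hc₁
  set a := res₀ hcH Ψ with ha
  -- the neighbour type `Θ₁ = Ψ^{(x l)} = (a, a^{(k)})`
  set Θ₁ := oflipCM c hc2 (x * (l : G)) Ψ with hΘ₁
  have hΘ₁0 : res₀ hcH Θ₁ = a := res₀_oflipCM_mul hcH hcen hc2 hx l Ψ
  have hΘ₁1 : res₁ hcH hcen x Θ₁ = oflipCM c₁ hc2' k a := by
    rw [hΘ₁, res₁_oflipCM_mul, hΨ, oflipCM_oflipCM_comm c₁ hc2' (l : H) k, oflipCM_oflipCM_self]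
  rcases hpartner with h | h
  · -- prism at `Θ₁` with `(k, l)`: transport = two-cycle − partner face − goal
    have hprism := transport_eq_twoCycle_sub_sub hc2 x Θ₁ k l
    have hback : oflipCM c hc2 (x * (l : G)) Θ₁ = Ψ := oflipCM_oflipCM_self c hc2 _ Ψ
    rw [hback] at hprism
    -- `gface Ψ l (xk) = two-cycle − partner − transport`
    have e : gface c hc2 Ψ (l : G) (x * (k : G)) = gface c hc2 (oflipCM c hc2 (x * (k : G)) Θ₁) (l : G) (x * (l : G)) -
        gface c hc2 (oflipCM c hc2 (l : G) Θ₁) (l : G) (x * (k : G)) - gface c hc2 Θ₁ (l : G) (x * (l : G)) := by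
      rw [hprism]; abel
    rw [e]
    refine Submodule.sub_mem _ (Submodule.sub_mem _ ?_ h) (hpar Θ₁ k (by rw [hΘ₁1, hΘ₁0]) l)
    -- the two-cycle at the diagonal type `(a, a)`
    refine twoCycle_mem_of_parallel hcH hcen hc2 hx N hpar _ ?_ l
    rw [res₁_oflipCM_mul, res₀_oflipCM_mul hcH hcen hc2 hx, hΘ₁1, hΘ₁0, oflipCM_oflipCM_self]
  · -- the partner carries its `k`-first face: prism at `Θ₂ = Ψ'^{(x k)} = (a^{(l)}, a)` with `(l, k)`, then swap along `x`
    set Ψ' := oflipCM c hc2 (l : G) (oflipCM c hc2 (x * (l : G)) Ψ) with hΨ'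
    have hΨ'0 : res₀ hcH Ψ' = oflipCM c₁ hc2' l a := by
      rw [hΨ', res₀_oflipCM_coe, res₀_oflipCM_mul hcH hcen hc2 hx]
    have hΨ'1 : res₁ hcH hcen x Ψ' = oflipCM c₁ hc2' k a := by
      rw [hΨ', res₁_oflipCM_coe hcH hcen hc2 hx, res₁_oflipCM_mul, hΨ, oflipCM_oflipCM_comm c₁ hc2' (l : H) k, oflipCM_oflipCM_self]
    set Θ₂ := oflipCM c hc2 (x * (k : G)) Ψ' with hΘ₂
    have hΘ₂0 : res₀ hcH Θ₂ = oflipCM c₁ hc2' l a := by rw [hΘ₂, res₀_oflipCM_mul hcH hcen hc2 hx, hΨ'0]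
    have hΘ₂1 : res₁ hcH hcen x Θ₂ = a := by rw [hΘ₂, res₁_oflipCM_mul, hΨ'1, oflipCM_oflipCM_self]
    have hprism := transport_eq_twoCycle_sub_sub hc2 x Θ₂ l k
    have hback : oflipCM c hc2 (x * (k : G)) Θ₂ = Ψ' := oflipCM_oflipCM_self c hc2 _ Ψ'
    rw [hback] at hprism
    -- the swapped type `Ψ'' = Θ₂^{(k)} = (a^{(l)(k)}, a)` carries its `k`-first face
    have hΨ'' : gface c hc2 (oflipCM c hc2 (k : G) Θ₂) (k : G) (x * (l : G)) ∈ N := by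
      have e : gface c hc2 (oflipCM c hc2 (k : G) Θ₂) (k : G) (x * (l : G)) =
          gface c hc2 (oflipCM c hc2 (x * (l : G)) Θ₂) (k : G) (x * (k : G)) - gface c hc2 Θ₂ (k : G) (x * (k : G)) -
            gface c hc2 Ψ' (k : G) (x * (l : G)) := by
        rw [hprism]; abel
      rw [e]
      refine Submodule.sub_mem _ (Submodule.sub_mem _ ?_ (hpar Θ₂ l (by rw [hΘ₂1, hΘ₂0, oflipCM_oflipCM_self]) k)) h
      refine twoCycle_mem_of_parallel hcH hcen hc2 hx N hpar _ ?_ k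
      rw [res₁_oflipCM_mul, res₀_oflipCM_mul hcH hcen hc2 hx, hΘ₂1, hΘ₂0]
    -- swap along `x`: `(Ψ''·x) = Ψ`
    have hswap : rt c x (oflipCM c hc2 (k : G) Θ₂) = Ψ := by
      apply ext_of_res hcH hcen hH hx
      · rw [res₀_rt_x hcH hcen hxc, res₁_oflipCM_coe hcH hcen hc2 hx, hΘ₂1]
      · rw [res₁_rt_x hcH hcen hxx hxc, res₀_oflipCM_coe, hΘ₂0, hΨ]
    have h2 := hN x _ hΨ''
    rwa [mapDomain_rt_x_mixed hc2 hxx hxc, hswap] at h2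

section Wt2

variable {K : Type*} [Group K] [Fintype K] [DecidableEq K] (c' : K)

omit [Fintype K] in
/-- Places are symmetric: `l ∈ {k, c k} ↔ k ∈ {l, c l}`. [folklore] -/
theorem mem_orb_symm (hc2' : c' * c' = 1) (k l : K) : l ∈ orb c' k ↔ k ∈ orb c' l := by
  rw [mem_orb, mem_orb]
  constructor
  · rintro (rfl | rfl)
    · exact Or.inl rfl
    · exact Or.inr (by rw [← mul_assoc, hc2', one_mul])
  · rintro (rfl | rfl)
    · exact Or.inl rfl
    · exact Or.inr (by rw [← mul_assoc, hc2', one_mul])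

/-- A deviation of a double flip `S^{(l)(k)}` from `S` lies at the place of `k` or of `l`. [folklore] -/
theorem dev_mem_orb_or (hc2' : c' * c' = 1) (S : CMF K c') (k l d : K)
    (hd1 : d ∈ (oflipCM c' hc2' k (oflipCM c' hc2' l S)).1) (hd0 : d ∉ S.1) : d ∈ orb c' k ∨ d ∈ orb c' l := by
  by_contra h
  rw [not_or] at h
  apply hd0
  have h1 : d ∈ (oflipCM c' hc2' l S).1 := by
    change d ∈ oflip c' k (oflipCM c' hc2' l S).1 at hd1
    rw [oflip, mem_symmDiff] at hd1
    rcases hd1 with ⟨h', -⟩ | ⟨h', -⟩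
    · exact h'
    · exact absurd h' h.1
  change d ∈ oflip c' l S.1 at h1
  rw [oflip, mem_symmDiff] at h1
  rcases h1 with ⟨h', -⟩ | ⟨h', -⟩
  · exact h'
  · exact absurd h' h.2

/-- **A double flip at two distinct places has weight `2`.** [folklore] -/
theorem wt_oflipCM_oflipCM_eq_two (hc2' : c' * c' = 1) (S : CMF K c') {k l : K} (hkl : l ∉ orb c' k) :
    wt c' (oflipCM c' hc2' k (oflipCM c' hc2' l S)) S = 2 := by
  rw [wt_comm c' hc2']
  have h1 : wt c' S (oflipCM c' hc2' l S) = 1 := by rw [wt_comm c' hc2']; exact wt_oflipCM_eq_one c' hc2' S l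
  have hkl' : k ∉ orb c' l := fun h => hkl ((mem_orb_symm c' hc2' l k).mp h)
  -- the element of `S` at the place of `k` agrees between `S` and `S^{(l)}`
  by_cases hk : k ∈ S.1
  · have hkY : k ∈ (oflipCM c' hc2' l S).1 := by
      change k ∈ oflip c' l S.1; rw [oflip, mem_symmDiff]; exact Or.inl ⟨hk, hkl'⟩
    rw [wt_oflipCM_of_mem c' hc2' hk hkY, h1]
  · have hck : c' * k ∈ S.1 := by by_contra h; exact hk ((S.2 k).mpr h)
    have hckl : c' * k ∉ orb c' l := fun h => hkl' (by have := cmul_mem_orb c' hc2' h; rwa [← mul_assoc, hc2', one_mul] at this)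
    have hkY : c' * k ∈ (oflipCM c' hc2' l S).1 := by
      change c' * k ∈ oflip c' l S.1; rw [oflip, mem_symmDiff]; exact Or.inl ⟨hck, hckl⟩
    rw [← oflipCM_cmul c' hc2' k, wt_oflipCM_of_mem c' hc2' hck hkY, h1]

end Wt2

omit [DecidablePred (· ∈ H)] in
/-- A mixed face depends on the PLACES of its two elements only. [folklore] -/
theorem gface_eq_of_orb (hcen : ∀ g : G, g * c = c * g) (hc2 : c * c = 1) (x : G) (T : CMF G c) {d k d' l : G}
    (hd : d = k ∨ d = c * k) (hd' : d' = l ∨ d' = c * l) : gface c hc2 T d (x * d') = gface c hc2 T k (x * l) := by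
  rcases hd with rfl | rfl <;> rcases hd' with rfl | rfl
  · rfl
  · rw [← mul_assoc, hcen x, mul_assoc, gface_cmul_snd]
  · rw [gface_cmul_fst]
  · rw [gface_cmul_fst, ← mul_assoc, hcen x, mul_assoc, gface_cmul_snd]

/-- **Both distance-lowering faces, hence the square element, at every distance-2 type** (spectator case): if `N` is base-change stable, contains
every parallel face at every neighbour type and ONE distance-lowering mixed face at EVERY type of distance `2`, then it contains every square
element `gface Ψ k (x·l) − gface Ψ l (x·k)`. [folklore] -/
theorem square_mem_of_parallel (hcH : c ∈ H) (hcen : ∀ g : G, g * c = c * g) (hc2 : c * c = 1) (hH : H.index = 2) {x : G} (hx : x ∉ H)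
    (hxx : x * x = 1) (hxc : ∀ g : G, g * x = x * g)
    (N : Submodule ℤ (CMF G c →₀ ℤ)) (hN : ∀ Q : G, ∀ y ∈ N, Finsupp.mapDomain (rt c Q) y ∈ N)
    (hpar : ∀ (Θ : CMF G c) (t : H), res₁ hcH hcen x Θ = oflipCM (⟨c, hcH⟩ : H) (csub_mul_csub hcH hc2) t (res₀ hcH Θ) →
      ∀ m : H, gface c hc2 Θ (m : G) (x * (m : G)) ∈ N)
    (hdev : ∀ Ψ : CMF G c, wt (⟨c, hcH⟩ : H) (res₁ hcH hcen x Ψ) (res₀ hcH Ψ) = 2 → ∃ d d' : H,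
      d ∈ (res₁ hcH hcen x Ψ).1 ∧ d ∉ (res₀ hcH Ψ).1 ∧ d' ∈ (res₁ hcH hcen x Ψ).1 ∧ d' ∉ (res₀ hcH Ψ).1 ∧ d ≠ d' ∧
      gface c hc2 Ψ (d : G) (x * (d' : G)) ∈ N)
    (Ψ : CMF G c) (h2 : wt (⟨c, hcH⟩ : H) (res₁ hcH hcen x Ψ) (res₀ hcH Ψ) = 2) (k l : H)
    (hk1 : k ∈ (res₁ hcH hcen x Ψ).1) (hk0 : k ∉ (res₀ hcH Ψ).1) (hl1 : l ∈ (res₁ hcH hcen x Ψ).1) (hl0 : l ∉ (res₀ hcH Ψ).1)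
    (hkl : k ≠ l) : gface c hc2 Ψ (k : G) (x * (l : G)) - gface c hc2 Ψ (l : G) (x * (k : G)) ∈ N := by
  have hc2' := csub_mul_csub hcH hc2
  set c₁ : H := ⟨c, hcH⟩ with hc₁
  -- one distance-lowering face at `Ψ` from the partner type at the place of its first element
  have key : ∀ k l : H, k ∈ (res₁ hcH hcen x Ψ).1 → k ∉ (res₀ hcH Ψ).1 → l ∈ (res₁ hcH hcen x Ψ).1 → l ∉ (res₀ hcH Ψ).1 → k ≠ l →
      gface c hc2 Ψ (l : G) (x * (k : G)) ∈ N := by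
    intro k l hk1 hk0 hl1 hl0 hkl
    have hΨ : res₁ hcH hcen x Ψ = oflipCM c₁ hc2' k (oflipCM c₁ hc2' l (res₀ hcH Ψ)) :=
      eq_oflipCM_oflipCM_of_wt_two c₁ hc2' h2 hk1 hk0 hl1 hl0 hkl
    have hlorb : (l : H) ∉ orb c₁ k := by
      rw [mem_orb]; rintro (h | h)
      · exact hkl h.symm
      · rw [h] at hl1; exact ((res₁ hcH hcen x Ψ).2 k).mp hk1 hl1
    have hkorb : (k : H) ∉ orb c₁ l := fun h => hlorb ((mem_orb_symm c₁ hc2' l k).mp h)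
    refine mixed_mem_of_parallel hcH hcen hc2 hH hx hxx hxc N hN hpar Ψ k l hΨ ?_
    -- the partner `Ψ' = Ψ^{(l)(x l)} = (a^{(l)}, a^{(k)})`
    set Ψ' := oflipCM c hc2 (l : G) (oflipCM c hc2 (x * (l : G)) Ψ) with hΨ'
    have hΨ'0 : res₀ hcH Ψ' = oflipCM c₁ hc2' l (res₀ hcH Ψ) := by
      rw [hΨ', res₀_oflipCM_coe, res₀_oflipCM_mul hcH hcen hc2 hx]
    have hΨ'1 : res₁ hcH hcen x Ψ' = oflipCM c₁ hc2' k (res₀ hcH Ψ) := by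
      rw [hΨ', res₁_oflipCM_coe hcH hcen hc2 hx, res₁_oflipCM_mul, hΨ, oflipCM_oflipCM_comm c₁ hc2' (l : H) k, oflipCM_oflipCM_self]
    have hpres : res₁ hcH hcen x Ψ' = oflipCM c₁ hc2' k (oflipCM c₁ hc2' l (res₀ hcH Ψ')) := by
      rw [hΨ'1, hΨ'0, oflipCM_oflipCM_self]
    have h2' : wt c₁ (res₁ hcH hcen x Ψ') (res₀ hcH Ψ') = 2 := by
      rw [hpres]; exact wt_oflipCM_oflipCM_eq_two c₁ hc2' _ hlorb
    obtain ⟨d, d', hd1, hd0, hd'1, hd'0, hne, hmem⟩ := hdev Ψ' h2'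
    have hd := dev_mem_orb_or c₁ hc2' (res₀ hcH Ψ') k l d (hpres ▸ hd1) hd0
    have hd' := dev_mem_orb_or c₁ hc2' (res₀ hcH Ψ') k l d' (hpres ▸ hd'1) hd'0
    -- two distinct deviations cannot share a place
    have hsame : ∀ m : H, ¬ (d ∈ orb c₁ m ∧ d' ∈ orb c₁ m) := by
      rintro m ⟨h1, h1'⟩
      rw [mem_orb] at h1 h1'
      have hcd : d' = c₁ * d ∨ d = c₁ * d' ∨ d = d' := by
        rcases h1 with rfl | rfl <;> rcases h1' with rfl | rfl
        · exact Or.inr (Or.inr rfl)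
        · exact Or.inl rfl
        · exact Or.inr (Or.inl rfl)
        · exact Or.inr (Or.inr rfl)
      rcases hcd with h | h | h
      · rw [h] at hd'1; exact ((res₁ hcH hcen x Ψ').2 d).mp hd1 hd'1
      · rw [h] at hd1; exact ((res₁ hcH hcen x Ψ').2 d').mp hd'1 hd1
      · exact hne h
    have hG : ∀ {m n : H}, m ∈ orb c₁ n → (m : G) = n ∨ (m : G) = c * n := fun {m n} h => by
      rw [mem_orb] at h
      rcases h with rfl | rfl
      · exact Or.inl rfl
      · exact Or.inr rfl
    rcases hd with hd | hd <;> rcases hd' with hd' | hd'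
    · exact absurd ⟨hd, hd'⟩ (hsame k)
    · right; rwa [gface_eq_of_orb hcen hc2 x Ψ' (hG hd) (hG hd')] at hmem
    · left; rwa [gface_eq_of_orb hcen hc2 x Ψ' (hG hd) (hG hd')] at hmem
    · exact absurd ⟨hd, hd'⟩ (hsame l)
  exact Submodule.sub_mem _ (key l k hl1 hl0 hk1 hk0 hkl.symm) (key k l hk1 hk0 hl1 hl0 hkl)

end

end Summit.HodgeConjecture.CorCM.Census.Spectator
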